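import Summits.HodgeConjecture.HodgeConjecture.Theses.EndoscopicMiddleDegree
import Literature.AlgebraicGeometry.ShimuraVarieties.HeckeCorrespondenceAction
import Literature.AlgebraicGeometry.HodgeTheory.ComplexGysinCorrespondence
import Literature.AlgebraicGeometry.HodgeTheory.HodgeFiltrationModelsReductionProofs
import Literature.AlgebraicGeometry.HodgeTheory.SupportedHodgeClassDescent
import Literature.AlgebraicTopology.SingularHomology.GysinMapSupportProofs

/-!
# Line `IdeatorThreeSketch` (card `impure-barren-envelope`) for crux
# `EndoscopicMiddleDegree.OrthogonalEnveloped` (stmt-HodgeConjecture-14300) — lead's skeleton, rev 2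

THE CRUX (rank 4, the automorphic heart of route EndoscopicMiddleDegree): for an orientation family `μ`
with Poincaré duality, `m ∈ {1,2}` (`n = m + 1`, `dim X = 2n`), a datum
`D : UnitaryBallQuotientDatum (2n) X` and a RATIONAL class `e ∈ H²ⁿ(X(ℂ); ℂ)` of Hodge type `(n,n)`
cup-orthogonal to the theta world `TW(D)`, there is `γ ∈ algebraicClasses (X ⊗ X) (2n)` whose action
`P_γ β = pr₁₊(pr₂^* β ∪ γ)` — the tree's `corrAction μ hX hX rfl γ`, `rfl` — preserves rational classes,
has purely `(n,n)` image and fixes `e`.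

THE LINE (ideator 3, `Ideas/impure-barren-envelope.md`; the theta world is inert). Let
`H = H²ⁿ(X(ℂ); ℂ)` and `𝓗 = Algebra.adjoin ℂ (range (D.heckeCorrespondenceAction (2n)))` the algebra of
the Hecke operators `T_g` (Literature `ShimuraVarieties/HeckeCorrespondenceAction`). The ℚ-BLOCKS of
`𝓗` — central idempotents of `𝓗` preserving rational classes and primitive among such — sum to `1`
(`stub_rationalBlocks`, LANDED p87916). Every element of `𝓗` is the action `P_γ` of an ALGEBRAIC class
`γ` on `X ⊗ X`: the `P_γ` form a subalgebra of `End H` (`stub_corrAlgebra`, LANDED p91059, from Fulton's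
composition of correspondences GRANTED the cup-multiplicativity of algebraic classes, i.e. the route's
support item `CupProductAlgebraic` on `X ⊗ (X ⊗ X)` = `stub_cupTriple`), and the generators `T_g` are `P_γ`
for the graph classes of the Hecke correspondences (`heckeGraphAlgebraic`, PROVED here from the
push–pull identity `P_{(π,π')₊1} = π₊ π'^*` and the one genuinely missing construction,
`stub_heckePushPull`: the Hecke correspondence of an admissible `g ∉ Γ` is `c • π₊ π'^*` through a
smooth projective level cover `S ⟶ X` — BMM Part 2 §1.8, Shimura §7.3; the tree only has the
TOPOLOGICAL cover `D.LevelCover (D.heckeLevel g)`). A block `ε` is PURE if `ε(H) ⊆ H^{n,n}`. THE BET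
`stub_impureBarren` (= IMPURE-BARREN = the Disproof's NoImpureRationalComponents = CoreVanishing, F5:
implied by HC and by nothing less in print): an impure ℚ-block kills every rational `(n,n)`-class
cup-orthogonal to `TW(D)`. `OrthogonalEnveloped_of` — the kernel-checked composition:
`γ := Σ_{ε pure} γ_ε` (`P_{γ_ε} = ε`); `P_γ = Σ_{pure} ε` preserves rational classes, is
`(n,n)`-valued (model-independence of Hodge types, `hodgePQ_independent_of_hodgeModel_holds`), and
`e = Σ_ε ε e = Σ_{pure} ε e = P_γ e` because the impure blocks kill `e`.

Registered stubs after the lead's reshape of cycle 1 (3 open + 2 landed): `stub_heckePushPull` (NEW,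
replaces rev-1 `stub_heckeGraphAlgebraic`, which is now the THEOREM `heckeGraphAlgebraic` below: the
algebraic Hecke covers in push–pull form — a CONSTRUCTION the tree lacks; XL), `stub_cupTriple`
(unchanged: the instance of the route's support item CupProductAlgebraic, stmt-HodgeConjecture-14350, that
Fulton's composition consumes; blocked exactly on that item / the named fact
`span_holomorphicBundleChernCharacter_eq_algebraicClasses`, Voisin I Thm 11.32 ⊗ ℂ), `stub_impureBarren`
(unchanged; OPEN; the lead's stub); `stub_corrAlgebra` (p91059) and `stub_rationalBlocks` (p87916) are
imported from their landed Theorems files. The line also needs the cup-multiplicativity only through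
`stub_corrAlgebra`'s hypothesis, so `stub_cupTriple` is the exact residue.
-/

noncomputable section

-- The crux-workfile namespace `Summit.<P>.<Sub>.Cruxes.…` repeats `HodgeConjecture` (single-conjunct summit).
set_option linter.dupNamespace false

namespace Summit.HodgeConjecture.HodgeConjecture.Cruxes.OrthogonalEnveloped.ImpureBarrenEnvelope

open scoped BigOperators
open CategoryTheory MonoidalCategory CartesianMonoidalCategory
open Literature.AlgebraicGeometry.Motives (SchemeOver ComplexPoints IsSmoothProjective)
open Literature.AlgebraicGeometry.Motives (IsSmoothProjective.tensor_holds)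
open Literature.AlgebraicGeometry.HodgeTheory
open Literature.AlgebraicGeometry.ShimuraVarieties
open Literature.AlgebraicTopology.SingularHomology
open Summit.HodgeConjecture.HodgeConjecture.Theses.EndoscopicMiddleDegree
  (OrthogonalEnveloped)

/-! ## The registered stubs (signatures in tree vocabulary; BYTE-IDENTICAL in the stub files) -/

/-- **Stub 1 — the Hecke correspondences are algebraic, in push–pull form (KNOWN in print, a
CONSTRUCTION missing in the tree: Shimura 1971 §7.3; BMM arXiv:1306.1515 Part 2 §1.8 / Thm 61; XL).**
For `μ` with Poincaré duality, `m ∈ {1,2}`, a datum `D` and an ADMISSIBLE `g ∉ Γ`, the Hecke operator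
`T_g = [Γ' : N_g]⁻¹ · τ ∘ π_g^*` on `H^{2(m+1)}(X(ℂ); ℂ)` equals `c • π₊ π'^*` for a smooth projective
`S` of dimension `2(m+1)` (on paper: the level cover `S(Γ ∩ g⁻¹Γg)`, algebraic by Baily–Borel + GAGA,
finite étale over `X`), scheme morphisms `π π' : S ⟶ X`, `π₊ = complexGysin μ` (Gysin = transfer for a
finite étale cover) and a scalar `c`. The tree has the cover only as the topological orbit quotient
`D.LevelCover (D.heckeLevel g)` with its `FiniteDeckCover` transfer. -/
theorem stub_heckePushPull :
    ∀ (μ : OrientationFamily), μ.HasPoincareDuality →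
      ∀ (m : ℕ) (X : SchemeOver ℂ) (D : UnitaryBallQuotientDatum (2 * (m + 1)) X), 1 ≤ m → m ≤ 2 →
        ∀ g : GL (Fin (2 * (m + 1) + 1)) D.E, D.IsHeckeAdmissible g → g ∉ D.Γ →
          ∃ (S : SchemeOver ℂ) (hS : IsSmoothProjective (2 * (m + 1)) S) (π π' : S ⟶ X) (c : ℂ),
            D.heckeCorrespondenceAction (2 * (m + 1)) g =
              c • (complexGysin μ hS D.isSmoothProjective π
                  (rfl : 2 * (m + 1) + 2 * (2 * (m + 1)) = 2 * (m + 1) + 2 * (2 * (m + 1))) ∘ₗ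
                (complexBetti.map π' (2 * (m + 1))).hom) := by
  sorry

/-- **Stub 2 — cup products of algebraic classes on the triple product are algebraic (KNOWN: Voisin II
Prop. 9.20; Fulton §19.2 with the moving lemma §11.4): the instance on `X ⊗ (X ⊗ X)`, `l = k = 2(m+1)`,
of the route's support item `CupProductAlgebraic` (stmt-HodgeConjecture-14350; in the tree proved only
GRANTED the named fact `span_holomorphicBundleChernCharacter_eq_algebraicClasses`, Voisin I Thm 11.32 ⊗ ℂ)
— verbatim the hypothesis `hCUP` of `stub_corrAlgebra` / `corrCompClass_mem_algebraicClasses`.** -/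
theorem stub_cupTriple :
    ∀ (m : ℕ) (X : SchemeOver ℂ), IsSmoothProjective (2 * (m + 1)) X →
      ∀ a ∈ algebraicClasses (X ⊗ (X ⊗ X)) (2 * (m + 1)),
        ∀ b ∈ algebraicClasses (X ⊗ (X ⊗ X)) (2 * (m + 1)),
          cupProduct ((Nat.mul_add 2 (2 * (m + 1)) (2 * (m + 1))).symm :
              2 * (2 * (m + 1)) + 2 * (2 * (m + 1)) = 2 * (2 * (m + 1) + 2 * (m + 1))) a b ∈
            algebraicClasses (X ⊗ (X ⊗ X)) (2 * (m + 1) + 2 * (m + 1)) := by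
  sorry

/-- **Stub 3 — LANDED p91059 (`Theorems/EndoscopicMiddleDegreeOrthogonalEnvelopedCorrAlgebra.lean`); kept
here as a registered signature until the farm serves the landed module to this skeleton (then: import).
The actions of algebraic self-correspondences form an algebra (KNOWN: Fulton §16.1 Prop. 16.1.1 /
Def. 16.1.2).** For `μ` with Poincaré duality and `X` smooth
projective of dimension `2(m+1)`, GRANTED the cup-multiplicativity of Stub 2 on `X ⊗ (X ⊗ X)`:
(i) `P_δ = id` for some algebraic `δ` (the diagonal `Δ_* 1`, by the projection formula
`complexGysin_cup`, `complexGysin_comp`, `complexGysin_id`, algebraic by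
`complexGysin_one_mem_algebraicClasses`); (ii) for algebraic `γ, γ'` there is an algebraic `γ''` with
`P_{γ''} = P_γ ∘ P_{γ'}` (`γ'' = c • p₁₃₊(p₁₂^* γ ∪ p₂₃^* γ')`: `corr_comp_of_baseChange` with the proved
`gysin_baseChange`, algebraic by `corrCompClass_mem_algebraicClasses`). -/
theorem stub_corrAlgebra :
    ∀ (μ : OrientationFamily), μ.HasPoincareDuality →
      ∀ (m : ℕ) (X : SchemeOver ℂ) (hX : IsSmoothProjective (2 * (m + 1)) X),
        (∀ a ∈ algebraicClasses (X ⊗ (X ⊗ X)) (2 * (m + 1)),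
          ∀ b ∈ algebraicClasses (X ⊗ (X ⊗ X)) (2 * (m + 1)),
            cupProduct ((Nat.mul_add 2 (2 * (m + 1)) (2 * (m + 1))).symm :
                2 * (2 * (m + 1)) + 2 * (2 * (m + 1)) = 2 * (2 * (m + 1) + 2 * (m + 1))) a b ∈
              algebraicClasses (X ⊗ (X ⊗ X)) (2 * (m + 1) + 2 * (m + 1))) →
        (∃ δ ∈ algebraicClasses (X ⊗ X) (2 * (m + 1)),
            corrAction μ hX hX
                (rfl : 2 * (m + 1) + 2 * (2 * (m + 1)) = 2 * (m + 1) + 2 * (2 * (m + 1))) δ =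
              LinearMap.id) ∧
        (∀ γ ∈ algebraicClasses (X ⊗ X) (2 * (m + 1)), ∀ γ' ∈ algebraicClasses (X ⊗ X) (2 * (m + 1)),
            ∃ γ'' ∈ algebraicClasses (X ⊗ X) (2 * (m + 1)),
              corrAction μ hX hX
                  (rfl : 2 * (m + 1) + 2 * (2 * (m + 1)) = 2 * (m + 1) + 2 * (2 * (m + 1))) γ'' =
                corrAction μ hX hX
                    (rfl : 2 * (m + 1) + 2 * (2 * (m + 1)) = 2 * (m + 1) + 2 * (2 * (m + 1))) γ ∘ₗ
                  corrAction μ hX hX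
                    (rfl : 2 * (m + 1) + 2 * (2 * (m + 1)) = 2 * (m + 1) + 2 * (2 * (m + 1))) γ') := by
  sorry

/-- **Stub 4 — LANDED p87916 (`Theorems/EndoscopicMiddleDegreeOrthogonalEnvelopedRationalBlocks.lean`); kept
here as a registered signature until the farm serves the landed module to this skeleton (then: import).
The ℚ-block decomposition of the Hecke algebra (KNOWN: the `ℚ`-Hecke-isotypic pieces, BMM Part 2 §1.9 /
Thm 61).** For `m ∈ {1,2}`
and a datum `D`, let `𝓗 = Algebra.adjoin ℂ (range (D.heckeCorrespondenceAction (2n)))` on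
`H = H²ⁿ(X(ℂ); ℂ)`. There is a finite family `s` of pairwise orthogonal endomorphisms summing to `1`,
each of which lies in `𝓗`, is idempotent, central in `𝓗`, preserves rational classes, and is PRIMITIVE
among the rational-preserving central idempotents `f` of `𝓗` (`f ε ∈ {0, ε}`). Proof: the `ℚ`-algebra
`R = {T ∈ Z(𝓗) | T preserves rational classes}` embeds in `End_ℚ` of the rational classes (rational
classes span `H`, `span_isRationalClass_eq_top_of_isSmoothProjective_holds`), which are
finite-dimensional over `ℚ` (`finite_singularCohomology_rat_complexPoints` and the injective
`ringChange`), so `R` is commutative Artinian and `exists_finset_primitive_idempotents R` applies;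
the Hecke operators preserve rational classes (`isRationalClass_heckeCorrespondenceAction`). -/
theorem stub_rationalBlocks :
    ∀ (m : ℕ) (X : SchemeOver ℂ) (D : UnitaryBallQuotientDatum (2 * (m + 1)) X), 1 ≤ m → m ≤ 2 →
      ∃ s : Finset (Module.End ℂ (complexBetti X (2 * (m + 1)))),
        (∀ ε ∈ s,
          ε ∈ Algebra.adjoin ℂ (Set.range (D.heckeCorrespondenceAction (2 * (m + 1)))) ∧
          ε * ε = ε ∧
          (∀ T ∈ Algebra.adjoin ℂ (Set.range (D.heckeCorrespondenceAction (2 * (m + 1)))),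
            T * ε = ε * T) ∧
          (∀ β, IsRationalClass β → IsRationalClass (ε β)) ∧
          (∀ f ∈ Algebra.adjoin ℂ (Set.range (D.heckeCorrespondenceAction (2 * (m + 1)))),
            f * f = f →
            (∀ T ∈ Algebra.adjoin ℂ (Set.range (D.heckeCorrespondenceAction (2 * (m + 1)))),
              T * f = f * T) →
            (∀ β, IsRationalClass β → IsRationalClass (f β)) → f * ε = 0 ∨ f * ε = ε)) ∧
        (∀ ε ∈ s, ∀ ε' ∈ s, ε ≠ ε' → ε * ε' = 0) ∧
        ∑ ε ∈ s, ε = 1 := by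
  sorry

/-- **Stub 5 — IMPURE-BARREN (THE BET = the route's CoreVanishing = the Disproof's
NoImpureRationalComponents, F5: implied by HC on the sector and by nothing less in print).** For
`m ∈ {1,2}`, a datum `D` and a ℚ-block `ε` of the Hecke algebra (as in `stub_rationalBlocks`) which is
IMPURE (some `ε β` is not of type `(n,n)`): `ε` kills every rational `(n,n)`-class `e` cup-orthogonal
to the theta world `TW(D) = SCⁿ ⊔ SConⁿ ⊔ Hdg^{m,m}_ℚ · N¹` (the crux's hypothesis, verbatim). Paper
content: by Matsushima + Arthur–Mok–KMSW the impure ℚ-pieces meeting `H^{n,n}` are exactly those whose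
coordinate-`0` summand at `τ₁` is cuspidal of dimension `≥ 2` ("wide cores", Disproof F5b); that they
carry no rational `(n,n)`-class is CoreVanishing (HC + irreducibility of `r(Ψ_a)` give it; nothing
unconditional does). -/
theorem stub_impureBarren :
    ∀ (m : ℕ) (X : SchemeOver ℂ) (D : UnitaryBallQuotientDatum (2 * (m + 1)) X), 1 ≤ m → m ≤ 2 →
      ∀ ε : Module.End ℂ (complexBetti X (2 * (m + 1))),
        ε ∈ Algebra.adjoin ℂ (Set.range (D.heckeCorrespondenceAction (2 * (m + 1)))) →
        ε * ε = ε →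
        (∀ T ∈ Algebra.adjoin ℂ (Set.range (D.heckeCorrespondenceAction (2 * (m + 1)))),
          T * ε = ε * T) →
        (∀ β, IsRationalClass β → IsRationalClass (ε β)) →
        (∀ f ∈ Algebra.adjoin ℂ (Set.range (D.heckeCorrespondenceAction (2 * (m + 1)))),
          f * f = f →
          (∀ T ∈ Algebra.adjoin ℂ (Set.range (D.heckeCorrespondenceAction (2 * (m + 1)))),
            T * f = f * T) →
          (∀ β, IsRationalClass β → IsRationalClass (f β)) → f * ε = 0 ∨ f * ε = ε) →
        (∃ β, ¬ IsOfHodgeType (2 * (m + 1)) X (2 * (m + 1)) (m + 1) (m + 1) (ε β)) →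
        ∀ e : complexBetti X (2 * (m + 1)), IsRationalClass e →
          IsOfHodgeType (2 * (m + 1)) X (2 * (m + 1)) (m + 1) (m + 1) e →
          (∀ x ∈ ((⨆ (W : Submodule D.E (Fin (2 * (m + 1) + 1) → D.E))
              (_ : IsTotallyPositive (conjRingHom D.E) D.H W) (_ : Module.finrank D.E W = m + 1),
              classesSupportedOn X (D.specialSubvariety W) (2 * (m + 1))) ⊔
            (⨆ (W : Submodule D.E (Fin (2 * (m + 1) + 1) → D.E))
              (_ : IsTotallyPositive (conjRingHom D.E) D.H W) (_ : Module.finrank D.E W = m)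
              (Z : Set X.left) (_ : IsClosed Z) (_ : Z ⊆ D.specialSubvariety W)
              (_ : ∀ z ∈ Z, ((m + 1 : ℕ) : ℕ∞) ≤ Order.coheight z),
              classesSupportedOn X Z (2 * (m + 1))) ⊔
            Submodule.span ℂ {z : complexBetti X (2 * (m + 1)) |
              ∃ a : complexBetti X (2 * m), IsRationalClass a ∧
                IsOfHodgeType (2 * (m + 1)) X (2 * m) m m a ∧
                ∃ d ∈ algebraicClasses X 1,
                  z = cupProduct (two_mul_add_two_mul m 1) a d}),
            cupProduct (two_mul_add_two_mul (m + 1) (m + 1)) e x = 0) →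
          ε e = 0 := by
  sorry

/-! ## Push–pull `[(f,g)₊1]_* = f₊ g^*` (= Literature `CorrespondenceActionOfGraph`, landed p92131; inlined here until
the farm serves that module) and the Hecke operators as actions of algebraic classes -/

/-- **Push–pull for a graph class** (Fulton §16.1: the correspondence `(f, g)_*[S]` acts by
`f_* ∘ g^*`). For smooth projective `S`, `X` of dimensions `d`, `n`, morphisms `f g : S ⟶ X` and
`d + e = n + n`, the Gysin image `γ = (f, g)₊ 1 ∈ H^{2e}((X ⊗ X)(ℂ); ℂ)` of `1 ∈ H⁰(S(ℂ); ℂ)` under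
`lift f g : S ⟶ X ⊗ X` acts on `Hᵃ(X(ℂ); ℂ)` by `[γ]_* β = pr₁₊(pr₂^* β ∪ (f,g)₊ 1) = f₊ (g^* β)`:
projection formula `pr₂^* β ∪ (f,g)₊ 1 = (f,g)₊((f,g)^* pr₂^* β ∪ 1)` (`complexGysin_cup`),
`∪ 1 = id`, `(f,g)^* pr₂^* = g^*` (`lift_snd`) and `pr₁₊ (f,g)₊ = ((f,g) ≫ pr₁)₊ = f₊`
(`complexGysin_comp`, `lift_fst`). Exact for every orientation family with Poincaré duality.
[cite: Fulton1998, §16.1 Prop. 16.1.1 and Def. 16.1.2] -/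
theorem corrAction_gysinGraph_one {μ : OrientationFamily} (hμ : μ.HasPoincareDuality)
    {d n : ℕ} {S X : SchemeOver ℂ} (hS : IsSmoothProjective d S) (hX : IsSmoothProjective n X)
    (f g : S ⟶ X) {e a b : ℕ} (hde : d + e = n + n) (hab : a + 2 * e = b + 2 * n) :
    corrAction μ hX hX hab
        (complexGysin μ hS (IsSmoothProjective.tensor_holds hX hX) (lift f g)
          (show 0 + 2 * (n + n) = 2 * e + 2 * d by omega)
          (singularCohomology.one ℂ (ComplexPoints S))) =
      complexGysin μ hS hX f (show a + 2 * n = b + 2 * d by omega) ∘ₗ (complexBetti.map g a).hom := by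
  have hXX := IsSmoothProjective.tensor_holds hX hX
  refine LinearMap.ext fun β => ?_
  rw [corrAction_apply, LinearMap.comp_apply,
    ← complexGysin_cup hμ hS hXX (lift f g) (Nat.add_zero a)
      (show a + 2 * (n + n) = a + 2 * e + 2 * d by omega)
      (show 0 + 2 * (n + n) = 2 * e + 2 * d by omega) rfl
      (complexBetti.map (snd X X) a β) (singularCohomology.one ℂ (ComplexPoints S)),
    cupProduct_one, ← CategoryTheory.comp_apply, ← complexBetti.map_comp, lift_snd,
    ← LinearMap.comp_apply (f := complexGysin μ hXX hX (fst X X) _),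
    ← complexGysin_comp hμ hS hXX hX (lift f g) (fst X X)]
  simp only [lift_fst]

/-- **Graph classes are algebraic**: for smooth projective `S`, `X` of dimensions `d`, `n`,
`f g : S ⟶ X` and `d + e = n + n`, `(f, g)₊ 1 ∈ Nᵉ H^{2e}((X ⊗ X)(ℂ); ℂ) = algebraicClasses (X ⊗ X) e`
(the class `φ_* 1` of the image of `φ = (f, g)`: proper push-forward shifts the coniveau filtration
by the relative dimension, `complexGysin_mem_supportedClasses` with the proved support property
`gysinMap_restrictCompl_eq_zero_of_field ℂ`, and `1 ∈ N⁰ H⁰ = H⁰`).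
[cite: FultonYoungTableaux1997, Appendix B §B.2 Exercise 5 and §B.3] -/
theorem gysinGraph_one_mem_algebraicClasses (μ : OrientationFamily) (hμ : μ.HasPoincareDuality)
    {d n : ℕ} {S X : SchemeOver ℂ} (hS : IsSmoothProjective d S) (hX : IsSmoothProjective n X) (f g : S ⟶ X)
    {e : ℕ} (hde : d + e = n + n) :
    complexGysin μ hS (IsSmoothProjective.tensor_holds hX hX) (lift f g)
        (show 0 + 2 * (n + n) = 2 * e + 2 * d by omega)
        (singularCohomology.one ℂ (ComplexPoints S)) ∈ algebraicClasses (X ⊗ X) e :=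
  complexGysin_mem_supportedClasses (gysinMap_restrictCompl_eq_zero_of_field ℂ) μ hμ hS
    (IsSmoothProjective.tensor_holds hX hX) (lift f g) _ (r := 0) (by omega)
    (by rw [supportedClasses_zero]; exact Submodule.mem_top)

/-- **Push–pull operators are actions of algebraic self-correspondences**: for `μ` with Poincaré
duality, `X` smooth projective of dimension `n`, and an operator `T = c • f₊ g^*` on `Hᵃ(X(ℂ); ℂ)`
through a smooth projective `S` of the same dimension `n` and `f g : S ⟶ X`, there is an algebraic
`γ ∈ Nⁿ H²ⁿ((X ⊗ X)(ℂ); ℂ)` with `[γ]_* = T`, namely `γ = c • (f, g)₊ 1` (the case of a Hecke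
correspondence presented on a level cover `S` with its two finite étale projections).
[cite: Fulton1998, §16.1 Prop. 16.1.1 and Def. 16.1.2] -/
theorem exists_algebraic_corrAction_eq_of_pushPull {μ : OrientationFamily} (hμ : μ.HasPoincareDuality)
    {n : ℕ} {X : SchemeOver ℂ} (hX : IsSmoothProjective n X) {a : ℕ} {T : complexBetti X a →ₗ[ℂ] complexBetti X a}
    (hT : ∃ (S : SchemeOver ℂ) (hS : IsSmoothProjective n S) (f g : S ⟶ X) (c : ℂ),
      T = c • (complexGysin μ hS hX f (rfl : a + 2 * n = a + 2 * n) ∘ₗ (complexBetti.map g a).hom)) :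
    ∃ γ ∈ algebraicClasses (X ⊗ X) n,
      corrAction μ hX hX (rfl : a + 2 * n = a + 2 * n) γ = T := by
  obtain ⟨S, hS, f, g, c, rfl⟩ := hT
  refine ⟨c • complexGysin μ hS (IsSmoothProjective.tensor_holds hX hX) (lift f g)
      (show 0 + 2 * (n + n) = 2 * n + 2 * n by omega)
      (singularCohomology.one ℂ (ComplexPoints S)),
    Submodule.smul_mem _ c (gysinGraph_one_mem_algebraicClasses μ hμ hS hX f g rfl), ?_⟩
  rw [map_smul, corrAction_gysinGraph_one hμ hS hX f g rfl rfl]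

/-- **Non-admissible `g`: `T_g = 0 = P_0`** (the junk value of `heckeCorrespondenceAction`; `P_γ` is
linear in `γ`). [folklore] -/
theorem exists_algebraic_corrAction_eq_hecke_of_not (μ : OrientationFamily) {p : ℕ}
    {X : SchemeOver ℂ} (D : UnitaryBallQuotientDatum p X) {g : GL (Fin (p + 1)) D.E}
    (hg : ¬ D.IsHeckeAdmissible g) (a : ℕ) :
    ∃ γ ∈ algebraicClasses (X ⊗ X) p,
      corrAction μ D.isSmoothProjective D.isSmoothProjective (rfl : a + 2 * p = a + 2 * p) γ =
        D.heckeCorrespondenceAction a g :=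
  ⟨0, zero_mem _, by rw [map_zero, D.heckeCorrespondenceAction_of_not hg]⟩

/-- **`γ ∈ Γ`: `T_γ = 1 = P_{Δ₊ 1}`** — the Hecke operator of an element of `Γ` is the identity
(`heckeCorrespondenceAction_of_mem`: `Γ γ Γ = Γ`), which is the action of the (algebraic) diagonal
class `Δ₊ 1 = (𝟙, 𝟙)₊ 1` (push–pull with `f = g = 𝟙 X`).
[cite: Shimura1973, §3.1 and Ch. 7 §7.2] [cite: Fulton1998, §16.1 Prop. 16.1.1 and Def. 16.1.2] -/
theorem exists_algebraic_corrAction_eq_hecke_of_mem {μ : OrientationFamily}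
    (hμ : μ.HasPoincareDuality) {p : ℕ} {X : SchemeOver ℂ} (D : UnitaryBallQuotientDatum p X)
    {g : GL (Fin (p + 1)) D.E} (hg : g ∈ D.Γ) (a : ℕ) :
    ∃ γ ∈ algebraicClasses (X ⊗ X) p,
      corrAction μ D.isSmoothProjective D.isSmoothProjective (rfl : a + 2 * p = a + 2 * p) γ =
        D.heckeCorrespondenceAction a g := by
  refine exists_algebraic_corrAction_eq_of_pushPull hμ D.isSmoothProjective
    ⟨X, D.isSmoothProjective, 𝟙 X, 𝟙 X, 1, ?_⟩
  rw [D.heckeCorrespondenceAction_of_mem hg, one_smul, complexGysin_id hμ D.isSmoothProjective a,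
    complexBetti.map_id, ModuleCat.hom_id, LinearMap.id_comp]
  rfl

/-- **Hecke operators are actions of algebraic self-correspondences** (the statement registered as
`stub_heckeGraphAlgebraic` in rev 1 of this skeleton, now a THEOREM from Stub 1): `T_g = P_γ` for an
algebraic `γ ∈ N^{2(m+1)} H^{4(m+1)}((X ⊗ X)(ℂ); ℂ)` — `γ = 0` for non-admissible `g`, `γ = Δ₊ 1` for
`g ∈ Γ`, and `γ = c • (π, π')₊ 1` for admissible `g ∉ Γ` by `stub_heckePushPull` and push–pull.
[cite: BergeronMillsonMoeglin2016Balls, Part 2 §1.8 and Thm. 61] [cite: Shimura1973, Ch. 7 §7.3] -/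
theorem heckeGraphAlgebraic :
    ∀ (μ : OrientationFamily), μ.HasPoincareDuality →
      ∀ (m : ℕ) (X : SchemeOver ℂ) (D : UnitaryBallQuotientDatum (2 * (m + 1)) X), 1 ≤ m → m ≤ 2 →
        ∀ g : GL (Fin (2 * (m + 1) + 1)) D.E,
          ∃ γ ∈ algebraicClasses (X ⊗ X) (2 * (m + 1)),
            corrAction μ D.isSmoothProjective D.isSmoothProjective
                (rfl : 2 * (m + 1) + 2 * (2 * (m + 1)) = 2 * (m + 1) + 2 * (2 * (m + 1))) γ =
              D.heckeCorrespondenceAction (2 * (m + 1)) g := by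
  intro μ hμ m X D hm1 hm2 g
  by_cases hadm : D.IsHeckeAdmissible g
  · by_cases hg : g ∈ D.Γ
    · exact exists_algebraic_corrAction_eq_hecke_of_mem hμ D hg _
    · exact exists_algebraic_corrAction_eq_of_pushPull hμ D.isSmoothProjective
        (stub_heckePushPull μ hμ m X D hm1 hm2 g hadm hg)
  · exact exists_algebraic_corrAction_eq_hecke_of_not μ D hadm _

/-! ## The composition -/

/-- **The crux from the stubs** (line `impure-barren-envelope`): with the ℚ-blocks `ε` of the Hecke
algebra (`stub_rationalBlocks`, landed), each the action of an algebraic class `γ_ε`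
(`heckeGraphAlgebraic` + `stub_corrAlgebra` (landed) + `stub_cupTriple`: the Hecke algebra lies in the
subalgebra of actions of algebraic self-correspondences), the envelope of a rational `(n,n)`-class
`e ⊥ TW(D)` is `γ := Σ_{ε pure} γ_ε`: its action `Σ_{pure} ε` preserves rational classes, is
`(n,n)`-valued, and fixes `e` since the impure blocks kill `e` (`stub_impureBarren`) and `Σ_ε ε = 1`. -/
theorem OrthogonalEnveloped_of : OrthogonalEnveloped := by
  intro μ hμ m X D hm1 hm2 e he hH horth
  classical
  -- the ℚ-blocks of the Hecke algebra
  obtain ⟨s, hblk, -, hsum⟩ := stub_rationalBlocks m X D hm1 hm2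
  -- the subalgebra of actions of algebraic self-correspondences contains the Hecke algebra
  obtain ⟨⟨δ, hδ, hδid⟩, hcomp⟩ :=
    stub_corrAlgebra μ hμ m X D.isSmoothProjective (stub_cupTriple m X D.isSmoothProjective)
  let S : Subalgebra ℂ (Module.End ℂ (complexBetti X (2 * (m + 1)))) :=
    { carrier := {T | ∃ γ ∈ algebraicClasses (X ⊗ X) (2 * (m + 1)),
        corrAction μ D.isSmoothProjective D.isSmoothProjective
          (rfl : 2 * (m + 1) + 2 * (2 * (m + 1)) = 2 * (m + 1) + 2 * (2 * (m + 1))) γ = T}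
      mul_mem' := by
        rintro _ _ ⟨γ, hγ, rfl⟩ ⟨γ', hγ', rfl⟩
        exact hcomp γ hγ γ' hγ'
      one_mem' := ⟨δ, hδ, hδid⟩
      add_mem' := by
        rintro _ _ ⟨γ, hγ, rfl⟩ ⟨γ', hγ', rfl⟩
        exact ⟨γ + γ', add_mem hγ hγ', map_add _ _ _⟩
      zero_mem' := ⟨0, zero_mem _, map_zero _⟩
      algebraMap_mem' := fun c ↦ ⟨c • δ, Submodule.smul_mem _ c hδ, by
        rw [map_smul, hδid, Algebra.algebraMap_eq_smul_one]; rfl⟩ }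
  have hle : Algebra.adjoin ℂ (Set.range (D.heckeCorrespondenceAction (2 * (m + 1)))) ≤ S := by
    refine Algebra.adjoin_le ?_
    rintro _ ⟨g, rfl⟩
    exact heckeGraphAlgebraic μ hμ m X D hm1 hm2 g
  -- each block is the action of an algebraic class
  have hεS : ∀ ε ∈ s, ∃ γ ∈ algebraicClasses (X ⊗ X) (2 * (m + 1)),
      corrAction μ D.isSmoothProjective D.isSmoothProjective
        (rfl : 2 * (m + 1) + 2 * (2 * (m + 1)) = 2 * (m + 1) + 2 * (2 * (m + 1))) γ = ε :=
    fun ε hε ↦ hle (hblk ε hε).1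
  choose! γf hγf hPγ using hεS
  -- the pure blocks and the envelope
  let pure : Module.End ℂ (complexBetti X (2 * (m + 1))) → Prop :=
    fun ε ↦ ∀ β, IsOfHodgeType (2 * (m + 1)) X (2 * (m + 1)) (m + 1) (m + 1) (ε β)
  have hP : corrAction μ D.isSmoothProjective D.isSmoothProjective
      (rfl : 2 * (m + 1) + 2 * (2 * (m + 1)) = 2 * (m + 1) + 2 * (2 * (m + 1)))
      (∑ ε ∈ s.filter pure, γf ε) = ∑ ε ∈ s.filter pure, ε := by
    rw [map_sum]
    exact Finset.sum_congr rfl fun ε hε ↦ hPγ ε (Finset.mem_filter.1 hε).1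
  refine ⟨∑ ε ∈ s.filter pure, γf ε,
    Submodule.sum_mem _ fun ε hε ↦ hγf ε (Finset.mem_filter.1 hε).1, ?_⟩
  intro P
  have hPβ : ∀ β, P β = ∑ ε ∈ s.filter pure, ε β := fun β ↦ by
    change corrAction μ D.isSmoothProjective D.isSmoothProjective
      (rfl : 2 * (m + 1) + 2 * (2 * (m + 1)) = 2 * (m + 1) + 2 * (2 * (m + 1)))
      (∑ ε ∈ s.filter pure, γf ε) β = _
    rw [hP, LinearMap.sum_apply]
  refine ⟨fun β hβ ↦ ?_, fun β ↦ ?_, ?_⟩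
  · -- rational classes are preserved: each block preserves them
    rw [hPβ]
    exact Finset.sum_induction _ (fun x ↦ IsRationalClass x) (fun a b ha hb ↦ ha.add hb)
      IsRationalClass.zero (fun ε hε ↦ (hblk ε (Finset.mem_filter.1 hε).1).2.2.2.1 β hβ)
  · -- the image is purely `(n,n)`: a sum of `(n,n)`-classes, tested in one Hodge model
    rw [hPβ]
    obtain ⟨A, -⟩ := hH
    rw [hodgePQ_independent_of_hodgeModel_holds.isOfHodgeType_iff D.isSmoothProjective A, map_sum]
    exact Submodule.sum_mem _ fun ε hε ↦
      (hodgePQ_independent_of_hodgeModel_holds.isOfHodgeType_iff D.isSmoothProjective A).1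
        ((Finset.mem_filter.1 hε).2 β)
  · -- `e` is fixed: `e = Σ_ε ε e` and the impure blocks kill `e`
    rw [hPβ]
    have he_sum : e = ∑ ε ∈ s, ε e := by
      conv_lhs => rw [show e = (∑ ε ∈ s, ε) e by rw [hsum]; rfl]
      rw [LinearMap.sum_apply]
    have hzero : ∑ ε ∈ s.filter (fun ε ↦ ¬ pure ε), ε e = 0 := by
      refine Finset.sum_eq_zero fun ε hε ↦ ?_
      obtain ⟨hεs, hnp⟩ := Finset.mem_filter.1 hε
      obtain ⟨h1, h2, h3, h4, h5⟩ := hblk ε hεs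
      exact stub_impureBarren m X D hm1 hm2 ε h1 h2 h3 h4 h5 (not_forall.1 hnp) e he hH horth
    conv_rhs => rw [he_sum, ← Finset.sum_filter_add_sum_filter_not s pure]
    rw [hzero, add_zero]

end Summit.HodgeConjecture.HodgeConjecture.Cruxes.OrthogonalEnveloped.ImpureBarrenEnvelope

end
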